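import Literature.NumberTheory.Transcendental.GoncharovFormalIteratedIntegralsProofs
import HarnessLib

/-!
# Goncharov's coproduct is coassociative, in coordinates: `conv` is associative
# (Goncharov 2005, Prop. 2.2 via Thm. 2.5: automorphisms of the path algebra compose)

`GoncharovFormalIteratedIntegralsProofs.lean` writes Goncharov's coproduct on families of
"iterated integrals" `J, K : S → List S → S → B` as the composite
`conv J K (a; w; b) = Σ_{splittings of w} J(a; kept letters; b) · ∏ K(gaps)` — the coordinates
`I_{a,w,b}(F_K ∘ F_J)` of the composite of the automorphisms `F_J`, `F_K` of the completed path
algebra with coordinates `J`, `K` ([Goncharov2005, Thm 2.5]: `F(p_{a,b}) = Φ_{a,b}`,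
`F(p_{a;c;b}) = Ψ(a; c; b) = Φ_{a,c₁} c₁ Φ_{c₁,c₂} ⋯ c_k Φ_{c_k,b}`), and proves there that `conv`
preserves the relations (ii), (iii) ([Goncharov2005, Prop 2.2], `conv_shuffle`, `conv_path`).
This file adds the remaining clause of [Goncharov2005, Prop 2.2] — **coassociativity** of `Δ` —
in the same coordinates and by Goncharov's argument (composition of automorphisms is
associative):

* `subst K a b f = ⟨f, Ψ^K(a; ·; b)⟩` is the automorphism `F_K` acting on a series `f` of paths
  from `a` to `b` (`conv J K a w b = subst K a b Φ^J_{a,b} (w)`, `conv_eq_subst`);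
* `subst_mul_X_mul`: `F_K` is a homomorphism for the composition of paths,
  `F_K(f · k · g) = F_K(f) · k · F_K(g)` (from `Ψ(a; d k e; b) = Ψ(a;d;k) k Ψ(k;e;b)`);
* `subst_psi`: hence `F_L(Ψ^K(a;c;b)) = Ψ^{conv K L}(a;c;b)`, and by linearity and triangularity
  `subst_subst`: `F_L ∘ F_K = F_{conv K L}`;
* `conv_assoc`: `conv (conv J K) L = conv J (conv K L)` — no hypothesis on the families.

Pairing `Δ` against three families with values in a common commutative ring, this is the
coassociativity `(Δ ⊗ id) ∘ Δ = (id ⊗ Δ) ∘ Δ` of Goncharov's coproduct (used in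
`BrownMotivicCoactionCoassociative.lean` for the motivic coaction of [Brown2012, Thm 2.4]).

## References

* A. B. Goncharov, *Galois symmetries of fundamental groupoids and noncommutative geometry*, Duke
  Math. J. **128** (2005), 209–284, §2.1, Prop. 2.2, §2.2, Thm. 2.5; arXiv:math/0208144.
  [Goncharov2005]
-/

noncomputable section

open scoped BigOperators

namespace Literature.NumberTheory.Transcendental

namespace GoncharovFormalIteratedIntegrals

universe u v

variable {S : Type u} {B : Type v} [CommRing B] [DecidableEq S]

open WordSeries

/-! ## Three more rules for the contraction `⟨φ, Ω⟩` -/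

/-- `⟨φ, e ↦ C·Ω(e)⟩ = C·⟨φ, Ω⟩` for a fixed series `C` (left multiplication in the
non-commutative series ring commutes with contraction against a triangular family). [folklore] -/
theorem contr_const_mul (φ C : WordSeries S B) {Θ : List S → WordSeries S B}
    (hΘ : ∀ c w, Θ c w ≠ 0 → List.Sublist c w) :
    (contr φ fun e => C * Θ e) = C * contr φ Θ := by
  ext w
  have h : ∀ k, contr φ Θ (w.drop k) = ∑ e ∈ subwords w, φ e * Θ e (w.drop k) := fun k =>
    contr_apply_eq_sum_of_subset φ hΘ (subwords_mono (List.drop_sublist k w))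
  rw [contr_apply, mul_apply]
  simp_rw [mul_apply, h, Finset.mul_sum]
  rw [Finset.sum_comm]
  refine Finset.sum_congr rfl fun k _ => Finset.sum_congr rfl fun e _ => ?_
  ring

/-- `⟨φ, d ↦ Ω(d)·R⟩ = ⟨φ, Ω⟩·R` for a fixed series `R`. [folklore] -/
theorem contr_mul_const (φ R : WordSeries S B) {Θ : List S → WordSeries S B}
    (hΘ : ∀ c w, Θ c w ≠ 0 → List.Sublist c w) :
    (contr φ fun d => Θ d * R) = contr φ Θ * R := by
  ext w
  have h : ∀ k, contr φ Θ (w.take k) = ∑ d ∈ subwords w, φ d * Θ d (w.take k) := fun k =>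
    contr_apply_eq_sum_of_subset φ hΘ (subwords_mono (List.take_sublist k w))
  rw [contr_apply, mul_apply]
  simp_rw [mul_apply, h, Finset.mul_sum, Finset.sum_mul]
  rw [Finset.sum_comm]
  refine Finset.sum_congr rfl fun k _ => Finset.sum_congr rfl fun d _ => ?_
  ring

/-- `⟨k, Θ⟩ = Θ(k)` for a letter `k` and a triangular family `Θ`. [folklore] -/
theorem contr_X (k : S) {Θ : List S → WordSeries S B}
    (hΘ : ∀ c w, Θ c w ≠ 0 → List.Sublist c w) : contr (X k) Θ = Θ [k] := by
  ext w
  rw [contr_apply]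
  simp_rw [X_apply, ite_mul, one_mul, zero_mul]
  rw [Finset.sum_ite_eq']
  split_ifs with h
  · rfl
  · by_contra hne
    exact h (mem_subwords.2 (hΘ _ _ (Ne.symm hne)))

/-! ## `Ψ` splits at a kept letter -/

/-- `Ψ(a; d k e; b) = Ψ(a; d; k) · k · Ψ(k; e; b)` (by definition: the path through the kept
letters `d k e` is the composite at the vertex `k`). [cite: Goncharov2005, Thm 2.5] -/
theorem psi_append_cons (K : S → List S → S → B) (k : S) (e : List S) (b : S) :
    ∀ (d : List S) (a : S), psi K a (d ++ k :: e) b = psi K a d k * X k * psi K k e b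
  | [], _ => rfl
  | j :: d, a => by
    rw [List.cons_append, psi_cons, psi_cons, psi_append_cons K k e b d j]
    simp only [mul_assoc]

/-! ## The automorphism `F_K` on series of paths from `a` to `b` -/

/-- **`F_K` on series**: `subst K a b f = ⟨f, Ψ^K(a; ·; b)⟩ = Σ_c f(c) Ψ^K(a; c; b)`, the image
under the automorphism `F_K` of the path algebra of the series `Σ_c f(c) p_{a;c;b}` of paths
from `a` to `b` ([Goncharov2005, Thm 2.5]: "`F` is uniquely determined by its values on the
generators `p_{a,b}`", `F(p_{a,b}) = Φ_{a,b}`). [cite: Goncharov2005, §2.2, Thm 2.5] -/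
def subst (K : S → List S → S → B) (a b : S) (f : WordSeries S B) : WordSeries S B :=
  contr f fun c => psi K a c b

/-- Coefficients of `F_K f`. [folklore] -/
theorem subst_apply (K : S → List S → S → B) (a b : S) (f : WordSeries S B) (w : List S) :
    subst K a b f w = ∑ c ∈ subwords w, f c * psi K a c b w := rfl

/-- `conv J K (a; ·; b)` is `F_K` applied to `Φ^J_{a,b}`. [cite: Goncharov2005, Thm 2.5] -/
theorem conv_eq_subst (J K : S → List S → S → B) (a : S) (w : List S) (b : S) :
    conv J K a w b = subst K a b (phi J a b) w :=
  conv_eq_contr J K a w b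

/-- `Φ^{conv J K}_{a,b} = F_K(Φ^J_{a,b})`. [cite: Goncharov2005, Thm 2.5] -/
theorem phi_conv (J K : S → List S → S → B) (a b : S) :
    phi (conv J K) a b = subst K a b (phi J a b) :=
  WordSeries.ext fun w => conv_eq_contr J K a w b

/-- Triangularity of `d ↦ ⟨g, e ↦ Ψ(a; d e; b)⟩`. [folklore] -/
theorem contr_psi_append_ne_zero (g : WordSeries S B) (K : S → List S → S → B) (a b : S)
    (d w : List S) (h : (contr g fun e => psi K a (d ++ e) b) w ≠ 0) : List.Sublist d w := by
  obtain ⟨e, -, he⟩ := Finset.exists_ne_zero_of_sum_ne_zero h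
  exact (List.sublist_append_left d e).trans
    (psi_apply_ne_zero K (d ++ e) a b w (right_ne_zero_of_mul he))

/-- **`F_K` is a homomorphism for the composition of paths**:
`F_K(f · k · g) = F_K(f) · k · F_K(g)` for series `f` of paths from `a` to `k` and `g` from `k`
to `b` ("`F` is an automorphism of the path algebra `P(S)` … for the `∘`-product").
[cite: Goncharov2005, §2.2, Thm 2.5] -/
theorem subst_mul_X_mul (K : S → List S → S → B) (a k b : S) (f g : WordSeries S B) :
    subst K a b (f * X k * g) = subst K a k f * X k * subst K k b g := by
  have hΩ : ∀ (x y : S) (c w : List S), psi K x c y w ≠ 0 → List.Sublist c w :=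
    fun x y c w => psi_apply_ne_zero K c x y w
  rw [subst, contr_mul _ _ (hΩ a b),
    contr_mul _ _ fun d w h => contr_psi_append_ne_zero g K a b d w h, subst, subst, mul_assoc,
    ← contr_mul_const f (X k * contr g fun c => psi K k c b) (hΩ a k)]
  congr 1
  funext d
  have tri : ∀ (c w : List S),
      (contr g fun e => psi K a (d ++ (c ++ e)) b) w ≠ 0 → List.Sublist c w := fun c w h => by
    obtain ⟨e, -, he⟩ := Finset.exists_ne_zero_of_sum_ne_zero h
    exact ((List.sublist_append_left c e).trans (List.sublist_append_right d (c ++ e))).trans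
      (psi_apply_ne_zero K (d ++ (c ++ e)) a b w (right_ne_zero_of_mul he))
  simp only [List.append_assoc]
  rw [contr_X k tri]
  simp only [List.singleton_append, psi_append_cons]
  rw [contr_const_mul g (psi K a d k * X k) (hΩ k b), mul_assoc]

/-- **`F_L(Ψ^K(a; c; b)) = Ψ^{conv K L}(a; c; b)`**: the composite automorphism on the paths
`p_{a;c;b}`. [cite: Goncharov2005, Thm 2.5] -/
theorem subst_psi (K L : S → List S → S → B) (b : S) :
    ∀ (c : List S) (a : S), subst L a b (psi K a c b) = psi (conv K L) a c b
  | [], a => by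
    rw [psi_nil, psi_nil]
    exact WordSeries.ext fun w => (conv_eq_contr K L a w b).symm
  | k :: c, a => by
    rw [psi_cons, psi_cons, subst_mul_X_mul, subst_psi K L b c k,
      show subst L a k (phi K a k) = phi (conv K L) a k from
        WordSeries.ext fun w => (conv_eq_contr K L a w k).symm]

/-- **`F_L ∘ F_K = F_{conv K L}`** on all series of paths from `a` to `b` (linearity and
triangularity reduce to `subst_psi`). [cite: Goncharov2005, Thm 2.5] -/
theorem subst_subst (K L : S → List S → S → B) (a b : S) (f : WordSeries S B) :
    subst L a b (subst K a b f) = subst (conv K L) a b f := by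
  ext w
  change ∑ c' ∈ subwords w, subst K a b f c' * psi L a c' b w =
    ∑ c ∈ subwords w, f c * psi (conv K L) a c b w
  have h1 : ∀ c' ∈ subwords w, subst K a b f c' = ∑ c ∈ subwords w, f c * psi K a c b c' :=
    fun c' hc' => contr_apply_eq_sum_of_subset f (fun c v => psi_apply_ne_zero K c a b v)
      (subwords_mono (mem_subwords.1 hc'))
  have h2 : ∀ c, psi (conv K L) a c b w = ∑ c' ∈ subwords w, psi K a c b c' * psi L a c' b w :=
    fun c => by rw [← subst_psi K L b c a]; rfl
  rw [Finset.sum_congr rfl fun c' hc' => by rw [h1 c' hc']]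
  simp_rw [h2, Finset.sum_mul, Finset.mul_sum]
  rw [Finset.sum_comm]
  refine Finset.sum_congr rfl fun c _ => Finset.sum_congr rfl fun c' _ => ?_
  ring

/-- **Goncharov's coproduct is coassociative** ([Goncharov2005, Prop 2.2]), in coordinates:
`conv (conv J K) L = conv J (conv K L)` for all families `J, K, L` with values in a commutative
ring — `I(F_L ∘ (F_K ∘ F_J)) = I((F_L ∘ F_K) ∘ F_J)` ([Goncharov2005, Thm 2.5 b)]). Pairing against
three families this is `(Δ ⊗ id) ∘ Δ = (id ⊗ Δ) ∘ Δ`. [cite: Goncharov2005, Prop 2.2, Thm 2.5] -/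
theorem conv_assoc (J K L : S → List S → S → B) (a : S) (w : List S) (b : S) :
    conv (conv J K) L a w b = conv J (conv K L) a w b := by
  rw [conv_eq_subst (conv J K) L, conv_eq_subst J (conv K L), phi_conv J K, subst_subst]

end GoncharovFormalIteratedIntegrals

end Literature.NumberTheory.Transcendental
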